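import Summits.NavierStokesRegularity.NavierStokesRegularity.Theorems.ExtremiserTransienceLerayPincerDefs
import Summits.NavierStokesRegularity.NavierStokesRegularity.Theorems.ExtremiserTransienceNearExtremalTransiencePerFlowOfFilamentSelectionAllTime
import Summits.NavierStokesRegularity.NavierStokesRegularity.Theorems.ExtremiserTransienceNearExtremalTransiencePerFlowMemberSelectionZoomInvariance
import Summits.NavierStokesRegularity.NavierStokesRegularity.Theorems.ExtremiserTransiencePerFlowScaleLockOfEnstrophyRate
import Summits.NavierStokesRegularity.NavierStokesRegularity.Theorems.ExtremiserTransienceKStarAttainedDensity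
import Summits.NavierStokesRegularity.NavierStokesRegularity.Theorems.ExtremiserTransienceFilamentGapSliceTools
import Summits.NavierStokesRegularity.NavierStokesRegularity.Theses.TypeIQuarterGate
import HarnessLib

/-!
# Route `ExtremiserTransience`, crux `NearExtremalTransiencePerFlow` (stmt-NavierStokesRegularity-26567),
# LINE g11-α «Leray pincer» (ideator ns-idea-5 g11): the skeleton `T ∧ Q♭ ⇒ crux` and the LADDER WELD `T ∧ QuarterLawTypeI ⇒ crux`,
# Theorems-side (BY NAME)

Theorems-side PORT, verbatim, of §2, §2b and §4 of the critic-passed crux workfile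
`Cruxes/NearExtremalTransiencePerFlow/Lines/leray_pincer.lean` (planner ns-idea-5 g11, commit b600d09ae385; idea-crit-4 g8 verdict
2026-08-29T09:11:26Z PASS; all credit for the argument is the author's — a `Cruxes/` file is not importable from `Theorems/`, hence the
port), over the texts of record `…Theorems.ExtremiserTransienceLerayPincerDefs`:

* `efficientTimesData_subseq` — near-efficient no-dust data restrict along a strictly increasing reindexing;
* `lerayRateOnEfficientTimes_of_quarterLaw : QuarterLawOnViolators → LerayRateOnEfficientTimes`;
* `quarterLawOnViolators_of_quarterLawTypeI : Theses.TypeIQuarterGate.QuarterLawTypeI → QuarterLawOnViolators` — the ladder rung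
  stmt-NavierStokesRegularity-23726 VERBATIM implies the violator-form quarter law (`IsMaximalSmoothSolution = classical ∧ ¬extension`
  is definitional, the violator's eventual rate `√(T−t)‖u‖ ≤ C√ν` is `IsTypeIBlowup` with constant `C√ν`, `lintegral → Bochner`);
* `lerayRateOnEfficientTimes_of_quarterLawTypeI : QuarterLawTypeI → LerayRateOnEfficientTimes` (Q♭ sits BELOW the rung 23726);
* `nearExtremalTransiencePerFlow_of_lerayPincer : TightOfBoundedBudget → LerayRateOnEfficientTimes → NearExtremalTransiencePerFlow` —
  the line's skeleton: violator frame → F1 `FilamentGap.flowFilamentBudget` → T0 `efficientTimesNoDust_holds` → Q♭ saturating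
  subsequence → T2′ `FilamentSelection.zoomPackageFlow` → member growth `ballEnergy_zoom_le` and BOUNDED member budgets
  (`enstrophy_zoom` + Leray's lower rate `PerFlow.lerayLowerRate_of_not_extends` + saturation) → T → flow compactness pins the limit
  to a slice of a Type-I ancient mild solution → `not_isExtremalSlice_of_typeIAncientMild`;
* **THE WELD** `nearExtremalTransiencePerFlow_of_tight_of_quarterLawTypeI :
  TightOfBoundedBudget → Theses.TypeIQuarterGate.QuarterLawTypeI → Theses.ExtremiserTransience.NearExtremalTransiencePerFlow` —
  crux ⟨26567⟩ ⇐ T ∧ rung ⟨23726⟩, by name: the first importable kernel object joining the ExtremiserTransience ladder to the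
  quarter-law ladder (idea-crit-4 g8, note N2).

Conditional results only: T (size L, static) and ⟨23726⟩ / Q♭ remain OPEN.  Landed `--supports stmt-NavierStokesRegularity-26567 --as helper`
by prover seat `ns-net-p1` (g14).  HONEST FRAMING: nothing about Navier–Stokes regularity or blow-up is proved here unconditionally;
no summit is proved by a line.
-/

noncomputable section

open scoped Topology InnerProductSpace RealInnerProductSpace ENNReal ContDiff
open MeasureTheory Filter Set Metric Function
open Literature.Analysis Literature.Analysis.FluidPDE
open Summit.NavierStokesRegularity.NavierStokesRegularity.Theses.ExtremiserTransience
open Summit.NavierStokesRegularity.NavierStokesRegularity.Theorems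
open Summit.NavierStokesRegularity.NavierStokesRegularity.Theorems.DepletionLadder.KStar.HalfSpace
open Summit.NavierStokesRegularity.NavierStokesRegularity.Theorems.NearExtremalTransiencePerFlow.ZoneTransversality
open Summit.NavierStokesRegularity.NavierStokesRegularity.Theorems.NearExtremalTransiencePerFlow.MemberSelection
open Summit.NavierStokesRegularity.NavierStokesRegularity.Theorems.NearExtremalTransiencePerFlow

namespace Summit.NavierStokesRegularity.NavierStokesRegularity.Theorems.NearExtremalTransiencePerFlow.LerayPincer

-- the problem directory repeats the summit name (`NavierStokesRegularity/NavierStokesRegularity`)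
set_option linter.dupNamespace false

/-! ## §2 Glue -/

/-- Near-efficient no-dust data restrict to near-efficient no-dust data along any strictly increasing reindexing. [folklore] -/
theorem efficientTimesData_subseq {ν T : ℝ} {u : ℝ → E3 → E3} {Θ : ℝ} {t Mb ε : ℕ → ℝ}
    (h : EfficientTimesData ν T u Θ t Mb ε) {ρ : ℕ → ℕ} (hρ : StrictMono ρ) :
    EfficientTimesData ν T u Θ (fun n => t (ρ n)) (fun n => Mb (ρ n)) (fun n => ε (ρ n)) := by
  obtain ⟨h1, h2, h3, h4, h5, h6, h7, h8⟩ := h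
  exact ⟨fun n => h1 _, h2.comp hρ.tendsto_atTop, h3.comp hρ.tendsto_atTop, fun n => h4 _, fun n x => h5 _ x,
    fun n => h6 _, fun n => h7 _, fun n => h8 _⟩

/-- Where Q♭ sits: the violator-form quarter law (all times) trivially gives Leray-rate saturation along every data sequence. -/
theorem lerayRateOnEfficientTimes_of_quarterLaw (hQ : QuarterLawOnViolators) : LerayRateOnEfficientTimes := by
  intro C ν T u p hV Θ t Mb ε hD
  obtain ⟨K, hK⟩ := hQ C ν T u p hV
  exact ⟨K, Eventually.frequently (Eventually.of_forall fun n => hK (t n) (hD.1 n))⟩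

/-! ## §2b LADDER WELD: rung `TypeIQuarterGate.QuarterLawTypeI` (stmt-NavierStokesRegularity-23726, VERBATIM) ⇒ `QuarterLawOnViolators` ⇒ Q♭ -/

/-- **23726 ⇒ the violator-form quarter law.**  (`IsMaximalSmoothSolution = classical ∧ ¬extension` is definitional; the violator's
eventual rate `√(T−t)‖u‖ ≤ C√ν` is `IsTypeIBlowup` with constant `C√ν`; the `lintegral` enstrophy bound is converted to the Bochner
integral.)  Port of the author's `quarterLawOnViolators_of_quarterLawTypeI` (ns-idea-5 g11). -/
theorem quarterLawOnViolators_of_quarterLawTypeI (hQ : Theses.TypeIQuarterGate.QuarterLawTypeI) : QuarterLawOnViolators := by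
  intro C ν T u p hV
  obtain ⟨hC, hν, hT, hsol, hLH, hdec, hrate, hext, -⟩ := hV
  have hmax : IsMaximalSmoothSolution ν 0 u p T := ⟨hsol, hext⟩
  have hTI : IsTypeIBlowup u T := by
    refine ⟨C * Real.sqrt ν, ?_⟩
    have hlt : ∀ᶠ t in 𝓝[<] T, t < T := self_mem_nhdsWithin
    filter_upwards [hrate, hlt] with t ht htT
    intro x
    have hpos : 0 < Real.sqrt (T - t) := Real.sqrt_pos.2 (sub_pos.2 htT)
    rw [le_div_iff₀ hpos, mul_comm]
    exact ht x
  obtain ⟨K, hK⟩ := hQ ν T hν hT u p hmax hLH hdec hTI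
  refine ⟨max K 0, fun t ht => ?_⟩
  have hpos : 0 < Real.sqrt (T - t) := Real.sqrt_pos.2 (sub_pos.2 ht.2)
  have hlin := hK t ht
  have hcont : Continuous (curl (u t)) := (DepletionLadder.KStar.contDiff_curl_top (hsol.contDiff_velocity ht)).continuous
  have hmeas : AEStronglyMeasurable (fun x => ‖curl (u t) x‖ ^ 2) volume := (hcont.norm.pow 2).aestronglyMeasurable
  rw [integral_eq_lintegral_of_nonneg_ae (Eventually.of_forall fun x => sq_nonneg _) hmeas]
  have h3 : ∫⁻ x, ENNReal.ofReal (‖curl (u t) x‖ ^ 2) = ∫⁻ x, ‖curl (u t) x‖ₑ ^ 2 :=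
    lintegral_congr fun x => FilamentGap.ofReal_norm_sq_eq_enorm_sq _
  rw [h3]
  have h4 : (∫⁻ x, ‖curl (u t) x‖ₑ ^ 2).toReal ≤ max (K / Real.sqrt (T - t)) 0 := by
    have h := ENNReal.toReal_mono ENNReal.ofReal_ne_top hlin
    rwa [ENNReal.toReal_ofReal'] at h
  calc (∫⁻ x, ‖curl (u t) x‖ₑ ^ 2).toReal * Real.sqrt (T - t) ≤ max (K / Real.sqrt (T - t)) 0 * Real.sqrt (T - t) := by
        gcongr
    _ ≤ max K 0 := by
        rcases le_or_gt 0 K with hK0 | hK0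
        · rw [max_eq_left (div_nonneg hK0 hpos.le), div_mul_cancel₀ _ hpos.ne', max_eq_left hK0]
        · rw [max_eq_right (div_neg_of_neg_of_pos hK0 hpos).le, zero_mul]
          exact le_max_right _ _

/-- **23726 ⇒ Q♭**: the flow heart of the line is BELOW the quarter-law rung of the ladder. -/
theorem lerayRateOnEfficientTimes_of_quarterLawTypeI (hQ : Theses.TypeIQuarterGate.QuarterLawTypeI) :
    LerayRateOnEfficientTimes :=
  lerayRateOnEfficientTimes_of_quarterLaw (quarterLawOnViolators_of_quarterLawTypeI hQ)

/-! ## §4 THE SKELETON: T + Q♭ ⇒ the crux BY NAME, and the weld with 23726 -/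

/-- **LINE g11-α SKELETON, Theorems-side** (port of the author's `NearExtremalTransiencePerFlow_of`, ns-idea-5 g11): stub T and stub Q♭
give the crux `NearExtremalTransiencePerFlow` (stmt-26567).  Violator frame by contradiction → F1 growth budget `A`
(`FilamentGap.flowFilamentBudget`) → T0 data (`efficientTimesNoDust_holds`) → Q♭: a saturating subsequence `ρ`
(`extraction_of_frequently_atTop`) → sub-data (`efficientTimesData_subseq`) → T2′ zoom family + flow compactness
(`FilamentSelection.zoomPackageFlow`) → member growth (`FilamentSelection.ballEnergy_zoom_le`) and BOUNDED member budgets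
(`ExtremiserTransience.enstrophy_zoom` + Leray's lower rate `PerFlow.lerayLowerRate_of_not_extends` + saturation) → T: centres,
subsequence, EXTREMAL limit `W₀` → flow compactness at those centres: `W₀ = W s` with `W` Type-I ancient mild, `s < 0` →
`not_isExtremalSlice_of_typeIAncientMild`. -/
theorem nearExtremalTransiencePerFlow_of_lerayPincer
    (hT : TightOfBoundedBudget) (hQ : LerayRateOnEfficientTimes) :
    NearExtremalTransiencePerFlow := by
  have hT0 : EfficientTimesNoDust := efficientTimesNoDust_holds
  intro C ν T hC hν hT' u p hsol hLH hdec hrate hsing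
  by_contra hno
  have hV : IsViolator C ν T u p := ⟨hC, hν, hT', hsol, hLH, hdec, hrate, hsing, hno⟩
  obtain ⟨A, hA⟩ := FilamentGap.flowFilamentBudget C ν T hC hν hT' u p hsol hLH hdec hrate
  obtain ⟨Θ, t₀, Mb₀, ε₀, hdata₀⟩ := hT0 C ν T u p hV
  -- Q♭ on T0's data: a saturating subsequence `ρ`
  obtain ⟨K, hfreq⟩ := hQ C ν T u p hV Θ t₀ Mb₀ ε₀ hdata₀
  obtain ⟨ρ, hρ, hρK⟩ := extraction_of_frequently_atTop hfreq
  have hdata : EfficientTimesData ν T u Θ (fun n => t₀ (ρ n)) (fun n => Mb₀ (ρ n)) (fun n => ε₀ (ρ n)) :=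
    efficientTimesData_subseq hdata₀ hρ
  -- T2′ on the sub-data
  obtain ⟨σ, Λ, Θ', ε', hσ, hfam, hcompF⟩ :=
    FilamentSelection.zoomPackageFlow C ν T u p hV Θ (fun n => t₀ (ρ n)) (fun n => Mb₀ (ρ n)) (fun n => ε₀ (ρ n)) hdata
  set t : ℕ → ℝ := fun n => t₀ (ρ n) with ht_def
  set Mb : ℕ → ℝ := fun n => Mb₀ (ρ n) with hMb_def
  set V : ℕ → E3 → E3 := fun n z => (Mb (σ n))⁻¹ • u (t (σ n)) ((ν / Mb (σ n)) • z) with hVdef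
  have hfamV : NearExtremalFamily V Λ Θ' ε' := hfam
  have htT : Tendsto (fun n => t (σ n)) atTop (𝓝[<] T) := by
    have h1 : Tendsto (fun n => t (σ n)) atTop (𝓝 T) := hdata.2.1.comp hσ.tendsto_atTop
    exact tendsto_nhdsWithin_iff.2 ⟨h1, Eventually.of_forall fun n => (hdata.1 (σ n)).2⟩
  -- eventual linear growth of the members
  have hgrV : ∀ᶠ n in atTop, ∀ (x : E3) (R : ℝ), 0 < R → ∫ z in Metric.ball x R, ‖V n z‖ ^ 2 ≤ A * R := by
    filter_upwards [htT.eventually hA] with n hn x R hR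
    have h := FilamentSelection.ballEnergy_zoom_le hν (hdata.2.2.2.1 (σ n)) hn 0 x hR
    simpa only [zero_add] using h
  -- bounded budgets of the members: zoom covariance + Leray's lower rate + saturation
  obtain ⟨c₀, hc₀, hler⟩ := DepletionLadder.PerFlow.lerayLowerRate_of_not_extends hν hT' hsol hLH hdec hsing
  have hZ : ∀ n, ∫ x, ‖curl (V n) x‖ ^ 2 ≤ K / (ν * (c₀ * Real.sqrt ν)) := by
    intro n
    have hMbp : 0 < Mb (σ n) := hdata.2.2.2.1 (σ n)
    have htn : t (σ n) ∈ Set.Ico 0 T := hdata.1 (σ n)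
    have hTt : 0 < T - t (σ n) := sub_pos.2 htn.2
    have hsq : 0 < Real.sqrt (T - t (σ n)) := Real.sqrt_pos.2 hTt
    have hsν : 0 < Real.sqrt ν := Real.sqrt_pos.2 hν
    set Z : ℝ := ∫ x, ‖curl (u (t (σ n))) x‖ ^ 2 with hZdef
    have hZnn : 0 ≤ Z := integral_nonneg fun _ => by positivity
    have hsat : Z * Real.sqrt (T - t (σ n)) ≤ K := hρK (σ n)
    have hKnn : 0 ≤ K := le_trans (mul_nonneg hZnn hsq.le) hsat
    obtain ⟨x₀, hx₀⟩ := hler (t (σ n)) htn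
    have hler' : c₀ * Real.sqrt ν ≤ Real.sqrt (T - t (σ n)) * Mb (σ n) :=
      hx₀.trans (mul_le_mul_of_nonneg_left (hdata.2.2.2.2.1 (σ n) x₀) hsq.le)
    have hz : ∫ x, ‖curl (V n) x‖ ^ 2 = (Mb (σ n))⁻¹ ^ 2 * (ν / Mb (σ n))⁻¹ * Z :=
      ExtremiserTransience.enstrophy_zoom (u (t (σ n))) _ (div_pos hν hMbp)
    have hz' : (Mb (σ n))⁻¹ ^ 2 * (ν / Mb (σ n))⁻¹ * Z = Z / (ν * Mb (σ n)) := by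
      field_simp
    rw [hz, hz', div_le_div_iff₀ (mul_pos hν hMbp) (mul_pos hν (mul_pos hc₀ hsν))]
    calc Z * (ν * (c₀ * Real.sqrt ν)) = ν * (Z * (c₀ * Real.sqrt ν)) := by ring
      _ ≤ ν * (Z * (Real.sqrt (T - t (σ n)) * Mb (σ n))) := by gcongr
      _ = ν * Mb (σ n) * (Z * Real.sqrt (T - t (σ n))) := by ring
      _ ≤ ν * Mb (σ n) * K := by gcongr
      _ = K * (ν * Mb (σ n)) := by ring
  have hZb : ∃ᶠ n in atTop, ∫ x, ‖curl (V n) x‖ ^ 2 ≤ K / (ν * (c₀ * Real.sqrt ν)) :=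
    (Eventually.of_forall hZ).frequently
  -- T: an extremal translate-limit; flow compactness identifies it with a slice of a Type-I ancient mild solution
  obtain ⟨y, φ, W₀, hφ, hconv, hext⟩ := hT V Λ Θ' ε' A _ hfamV hgrV hZb
  obtain ⟨ψ, K', s, W, hψ, hW, hs, hpin, hconvF⟩ := hcompF y φ hφ
  have hconv' : ∀ z : E3, Tendsto (fun n => V (φ (ψ n)) (y (φ (ψ n)) + z)) atTop (𝓝 (W s z)) := by
    intro z
    have h1 := hconvF s hs z
    simp only [sub_self, mul_zero, add_zero] at h1
    exact h1
  have hWs : W s = W₀ :=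
    funext fun z => tendsto_nhds_unique (hconv' z) ((hconv z).comp hψ.tendsto_atTop)
  subst hWs
  exact not_isExtremalSlice_of_typeIAncientMild hW hs hext

/-- **THE WELD** (port of the author's `NearExtremalTransiencePerFlow_of_quarterLawTypeI`): lemma T and the ladder rung `QuarterLawTypeI`
(stmt-NavierStokesRegularity-23726) together give the crux `NearExtremalTransiencePerFlow` (stmt-26567), BY NAME. -/
theorem nearExtremalTransiencePerFlow_of_tight_of_quarterLawTypeI
    (hT : TightOfBoundedBudget) (hQ : Theses.TypeIQuarterGate.QuarterLawTypeI) :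
    NearExtremalTransiencePerFlow :=
  nearExtremalTransiencePerFlow_of_lerayPincer hT (lerayRateOnEfficientTimes_of_quarterLawTypeI hQ)

end Summit.NavierStokesRegularity.NavierStokesRegularity.Theorems.NearExtremalTransiencePerFlow.LerayPincer

end
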